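import Summits.ABC.IUTFork.Joshi.Arithmeticoids2
import Summits.ABC.IUTFork.Joshi.ArithmeticoidFrobenioids
import Summits.ABC.IUTFork.Joshi.ArithmeticoidsToyModel
import Mathlib.Topology.Instances.ZMod

/-!
# NON-VACUITY WITNESSES for the signatures of `Joshi/Arithmeticoids2.lean` / `Joshi/ArithmeticoidFrobenioids.lean` ([J-2½] arXiv:2305.10398
# §5: `TiltDatum`, `ResidueDatum` over `BRingDatum`, `Deformation`) at seat E-t37's one-place toy `toyDatum`, and the toy's verdicts

Block E support file (cell abc-iut, rung LADDER-ABC:A2.E, seat abc-iut-E-t46; author-side NV duty per E-plan-2 08:22:53Z «AUTHORS FIRST for NV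
witnesses of their own interface structures»). The object files `Joshi/Arithmeticoids2.lean` (p432942) and `Joshi/ArithmeticoidFrobenioids.lean`
(p432956, v2 p433348) add to seat E-t37's `DeformationDatum` two HYPOTHESIS structures — `TiltDatum` (the tilting data of Def. 5.1.1 / Def. 5.1.7)
and `ResidueDatum` (the residue surjections `η_{y_v} : B_{L_v} ↠ K_{y_v}` of Thm. 5.13.1's proof, over E-t37's `BRingDatum` of Def. 4.5.1) —
and the packaging structure `Deformation` (Def. 5.8.1). This file certifies, at E-t37's DEGENERATE toy `toyDatum` (`Joshi/ArithmeticoidsToyModel.lean`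
p432522: `L = ℚ`, one non-archimedean place, `L_v = K = ℚ(X)` with the degree absolute value, one point), that their fields are jointly
satisfiable: `toyTilt` (tilts `𝔽₂`, base fields `𝔽₂`), `toyBRing` (`B_{L_v} = ℚ(X) = B^+`, `ϕ = 1`, `π = X`), `toyResidue` (`η = id`). `Deformation`
is inhabited in general by `DeformationDatum.deformationOf` whenever the residue fields are algebraically closed (Def. 5.1.1), which the toy's
`ℚ(X)` is not — no toy instance is claimed for it. TOY VERDICTS (documentation that hypotheses / claims are CONTENTFUL, nothing about number
fields): the toy tilt `R^♭_y = (Unit → 𝔽₂)` has characteristic `2` (`not_charZero_toyTilt`) — so the unboundedness hypothesis of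
`TiltDatum.tilt_charZero` (Def. 5.1.7 note (2)) is not idle; Thm. 5.13.1 instantiates (`toy_thm5131`); `Thm5121_2_top` HOLDS in the toy
(`toy_thm5121_2_top`); `Prop5151v2` holds VACUOUSLY in the toy (`base = cp ≠ algClosure`; the deprecated v1 likewise, not restated). A model exhibits satisfiability, nothing
more; nothing here is a statement about Joshi's mathematics or about [IUTchIII] Cor. 3.12; typed ≠ proved; no side taken. [claim:
Joshi2023ATS2half, status: disputed] applies to the quoted claim-`Prop`s only; the model itself is [folklore].
-/

noncomputable section

open TopologicalSpace

namespace Summit.ABC.IUTFork.Joshi.ATS2h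

/-! ## The tilt signature at the toy -/

/-- A toy `TiltDatum` over `toyDatum`: tilts and base fields all `𝔽₂ = ZMod 2` (discrete), tilting isomorphisms the identity; `CharP 𝔽₂ 2`
matches the toy's `p_v = 2`. [folklore] -/
def toyTilt : toyDatum.TiltDatum (fun _ => ZMod 2) (fun _ _ => ZMod 2) where
  tiltIso := fun _ _ => RingEquiv.refl _
  continuous_tiltIso := fun _ _ => continuous_id
  continuous_tiltIso_symm := fun _ _ => continuous_id
  charP_nonarch := fun _ _ _ => by
    show CharP (ZMod 2) 2
    infer_instance

/-- `TiltDatum` is inhabited over the toy carriers. [folklore] -/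
theorem toyTilt_nonempty : Nonempty (toyDatum.TiltDatum (fun _ => ZMod 2) (fun _ _ => ZMod 2)) := ⟨toyTilt⟩

/-- TOY VERDICT on Def. 5.1.7 note (2): the toy tilt `R^♭_y = (Unit → 𝔽₂)` is NOT of characteristic zero (`2 = 0` there) — the hypothesis
«residue characteristics unbounded» of `TiltDatum.tilt_charZero` carries the content. [folklore] -/
theorem not_charZero_toyTilt (y : toyDatum.Arith) : ¬ CharZero (toyTilt.tilt y) := by
  intro h
  have h2 : ((2 : ℕ) : toyTilt.tilt y) ≠ 0 := Nat.cast_ne_zero.2 (by norm_num)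
  apply h2
  funext v
  show ((2 : ℕ) : ZMod 2) = 0
  decide

/-- Prop. 5.1.8 at the toy: the two (equal) toy arithmeticoids have topologically isomorphic tilts. [folklore] -/
theorem toy_prop518 (y₁ y₂ : toyDatum.Arith) : ∃ e : toyTilt.tilt y₁ ≃+* toyTilt.tilt y₂, Continuous e ∧ Continuous e.symm :=
  toyTilt.prop518 y₁ y₂

/-! ## The `B`-ring and residue signatures at the toy; Thm. 5.13.1 instantiated -/

/-- A toy `BRingDatum` over `toyDatum`: `B_{L_v} = ℚ(X) = B^+_{L_v}`, `ϕ_v = 1`, `π_v = X` (so `B^{ϕ=π} = 0`-eigenspace bookkeeping is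
degenerate). [folklore] -/
def toyBRing : toyDatum.BRingDatum (fun _ => RatFunc ℚ) where
  Bplus := fun _ => ⊤
  Bplus_arch := fun _ h => (Set.notMem_empty _ h).elim
  frobB := fun _ => RingHom.id _
  frobB_algebraMap := fun _ _ => rfl
  frobB_arch := fun _ h => (Set.notMem_empty _ h).elim
  unif := fun _ => RatFunc.X
  unif_arch := fun _ h => (Set.notMem_empty _ h).elim

/-- `BRingDatum` is inhabited over the toy carriers (seat E-t37's toy does not cover it). [folklore] -/
theorem toyBRing_nonempty : Nonempty (toyDatum.BRingDatum (fun _ => RatFunc ℚ)) := ⟨toyBRing⟩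

/-- A toy `ResidueDatum` over `toyBRing`: `η_{y_v} = id : ℚ(X) → ℚ(X)` (surjective, continuous, closed kernel `{0}`). [folklore] -/
def toyResidue : toyDatum.ResidueDatum toyBRing where
  eta := fun _ _ => RingHom.id _
  eta_surjective := fun _ _ => Function.surjective_id
  continuous_eta := fun _ _ => continuous_id
  isClosed_ker := fun _ _ => by
    have : ((RingHom.ker (RingHom.id (RatFunc ℚ)) : Ideal (RatFunc ℚ)) : Set (RatFunc ℚ)) = {0} := by
      ext x
      simp [RingHom.mem_ker]
    rw [this]
    exact isClosed_singleton

/-- `ResidueDatum` is inhabited over the toy carriers. [folklore] -/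
theorem toyResidue_nonempty : Nonempty (toyDatum.ResidueDatum toyBRing) := ⟨toyResidue⟩

/-- Thm. 5.13.1 at the toy: `B_L ⧸ I_y ≃+* R_y` instantiates (here `I_y = 0`). [folklore] -/
def toy_thm5131 (y : toyDatum.Arith) : toyBRing.BL ⧸ toyResidue.Iy y ≃+* toyDatum.arithRing y := toyResidue.thm5131 y

/-- In the toy, `I_y = 0`. [folklore] -/
theorem toy_Iy_eq_bot (y : toyDatum.Arith) : toyResidue.Iy y = ⊥ := by
  ext b
  rw [toyResidue.mem_Iy_iff]
  simp only [Ideal.mem_bot, funext_iff]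
  exact Iff.rfl

/-! ## Toy verdicts on the claim-`Prop`s of `Joshi/Arithmeticoids2.lean` / `Joshi/ArithmeticoidFrobenioids.lean` -/

/-- [J-2½] Thm. 5.12.1 (2), topological clause (`Thm5121_2_top`) HOLDS in the toy: one arithmeticoid, the identity isomorphism. [folklore] -/
theorem toy_thm5121_2_top : toyDatum.Thm5121_2_top := by
  intro y₁ y₂ v
  obtain rfl : y₁ = y₂ := toy_arith_subsingleton y₁ y₂
  exact ⟨RingEquiv.refl _, continuous_id, continuous_id⟩

/-- [J-2½] Prop. 5.15.1 as typed (`Prop5151v2`) holds VACUOUSLY in the toy: the toy is formed over `F_v = ℂ^♭_{p_v}` (`base = cp`), not over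
Def. 4.1.1's `𝒴_L`. [folklore] -/
theorem toy_prop5151v2 : toyDatum.Prop5151v2 := fun h => by
  simp [DeformationDatum.IsDef411, toyDatum] at h

end Summit.ABC.IUTFork.Joshi.ATS2h
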